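import Summits.AnomalousDissipation.AnomalousDissipation.Theorems.SolenoidalFractalHomogenisationLagrangianCarrierStreamPotentialWord
import Summits.AnomalousDissipation.AnomalousDissipation.Theorems.SolenoidalFractalHomogenisationLagrangianCarrierStreamPushforward
import Summits.AnomalousDissipation.AnomalousDissipation.Theorems.SolenoidalFractalHomogenisationLagrangianCarrierConstructionOneDirectional
import Summits.AnomalousDissipation.AnomalousDissipation.Theorems.SolenoidalFractalHomogenisationLagrangianRenormalisationStepExistsL
import Summits.AnomalousDissipation.AnomalousDissipation.Theorems.SolenoidalFractalHomogenisationLagrangianStepTailScales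
import Summits.AnomalousDissipation.AnomalousDissipation.Theorems.SolenoidalFractalHomogenisationPermissibleFractalCarrierRegular
import HarnessLib

/-!
# K1L `LagrangianRenormalisationStep` (stmt-AnomalousDissipation-24912), registered stub `stub_tailL`: the LAGRANGIAN LEVELS as weak
# divergences of bounded antisymmetric stream potentials, and the template bookkeeping of their sizes (helper; `--supports stmt-AnomalousDissipation-24912`)

Summits-side helper file (everything proved; no definitions, no named facts).  Ruling R23-1 (A) of the cell: the tail step of K1L is run in
STREAM form.  For an abstract Lagrangian lattice carrier `E` (`IsLagrangian`, `LevelRegular`) whose coarse flows have bounded derivative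
`‖flowDeriv m t w y‖ ≤ μ` on the refresh windows of level `m+1` (`w` the window's left end — the `UniformFlowDistortion` shape delivered under the
strain-budget ceiling by `…RegularLWindowDistortion.flowDeriv_window_distortion_le`, μ = 11/10):

* `exists_level_stream_potential`: at every time `t`, the Lagrangian level `b (m+1) t` is the weak divergence `Σ_i ∂_i ψ_{ia}` of an antisymmetric,
  continuous potential with `|ψ| ≤ 9 μ² · k a_{m+1} / (2π² N_{m+1}²)` — the Eulerian word potential (`…StreamPotentialWord`) pushed forward along the
  window's coarse flow (`…StreamPushforward`, `IsInserted`);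
* `norm_b_succ_le_of_flowDeriv_le`: `‖b (m+1) t x‖ ≤ μ · k a_{m+1} / (2π N_{m+1})`;
* bookkeeping on the K1L template (`Permissible`, (T2), `N_m² ≤ N_{m+1}`, amplitude decay (A)): `kbar` is antitone, the potential scales
  `a_{m+1}/N_{m+1}²` are summable with tail `Σ_{m ≥ j} a_{m+1}/N_{m+1}² ≤ kbar_j · q^j / ((1 − q) gain)`, `q = 2^{-1/4}`
  (`tsum_potentialScale_tail_le`), and the velocity scales `a_{m+1}/N_{m+1}` are summable (`summable_amplitudeScale`).

These are the levelwise inputs of `Literature/…/PassiveVectorTensorStreamSeries.stream_of_levels_tail`; the assembly of `stub_tailL` is the sibling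
file `…LagrangianRenormalisationStepTailL`.  Infrastructure for route-1's rung leaf F-D1.A0 (a frontier FORMAL rung); NOT a proof of anomalous dissipation.
-/

set_option linter.dupNamespace false

noncomputable section

namespace Summit.AnomalousDissipation.AnomalousDissipation.Theorems.SolenoidalFractalHomogenisation.LagrangianRenormalisationStep

open Set Function Filter Topology MeasureTheory
open scoped NNReal
open Literature.Analysis Literature.Analysis.FunctionSpaces Literature.Analysis.FunctionSpaces.Torus
open Literature.Analysis.FluidPDE Literature.Analysis.FluidPDE.LatticeShear
open Summit.AnomalousDissipation.AnomalousDissipation.Theorems.SolenoidalFractalHomogenisation.PermissibleCarrier (norm_level_le two_pow_le_N)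
open Summit.AnomalousDissipation.AnomalousDissipation.Theorems.SolenoidalFractalHomogenisation.LagrangianCarrier
  (integral_cell_mul_eq_neg_integral_potential abs_cellPotential_le integral_pushforward_mul_eq_neg_integral_potential
    pushforwardPotential_antisymm abs_pushforwardPotential_le)
open Summit.AnomalousDissipation.AnomalousDissipation.Theorems.SolenoidalFractalHomogenisation.LagrangianCarrierConstruction (mem_window_floor)

variable {k : ℕ}

/-! ## §1 The coarse flow on a window: inverse, derivative entries -/

/-- The flow maps of a regular carrier invert each other: `X m s t (X m t s y) = y`. [cite: ArmstrongVicol2025, §2.2 (PDF p. 18: the flows X_m)] -/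
theorem X_X_symm (E : LagrangianLatticeCarrier k) (hLR : E.LevelRegular) (m : ℕ) (s t : ℝ) (y : UnitAddTorus (Fin 3)) :
    E.X m s t (E.X m t s y) = y := by
  have h := congrFun (hLR.X_comp_X m s t s) y
  rw [Function.comp_apply, hLR.X_self m s] at h
  exact h

/-- The flow derivative read on the torus derivative of the displacement: `flowDeriv m t w y = id + D(disp m t w)(y)`. [folklore] -/
theorem flowDeriv_eq_id_add_fderiv (E : LagrangianLatticeCarrier k) (m : ℕ) (t w : ℝ) (y : UnitAddTorus (Fin 3)) :
    E.flowDeriv m t w y = ContinuousLinearMap.id ℝ (EuclideanSpace ℝ (Fin 3)) + Torus.fderiv (E.disp m t w) y := by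
  rw [LagrangianLatticeCarrier.flowDeriv, fderiv_lift, proj_repr]

/-- The matrix entries of the flow derivative: `(flowDeriv m t w y e_c)_i = δ_{ic} + ∂_c (disp m t w)_i (y)` for a smooth displacement. [folklore] -/
theorem flowDeriv_apply_single (E : LagrangianLatticeCarrier k) (m : ℕ) (t w : ℝ) (hsm : IsSmooth (E.disp m t w))
    (y : UnitAddTorus (Fin 3)) (i c : Fin 3) :
    (E.flowDeriv m t w y (EuclideanSpace.single c (1:ℝ))) i =
      (if i = c then (1:ℝ) else 0) + Torus.partialDeriv c (E.disp m t w) y i := by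
  have h1 : IsContDiff 1 (E.disp m t w) := hsm.isContDiff (by exact_mod_cast le_top)
  rw [flowDeriv_eq_id_add_fderiv, partialDeriv_eq_fderiv_apply h1 c y]
  simp only [_root_.add_apply, ContinuousLinearMap.id_apply, PiLp.add_apply, EuclideanSpace.single,
    PiLp.single_apply]

/-- Entry bound: `|δ_{ic} + ∂_c (disp m t w)_i (y)| ≤ ‖flowDeriv m t w y‖`. [folklore] -/
theorem abs_flowDeriv_entry_le (E : LagrangianLatticeCarrier k) (m : ℕ) (t w : ℝ) (hsm : IsSmooth (E.disp m t w))
    (y : UnitAddTorus (Fin 3)) (i c : Fin 3) :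
    |(if i = c then (1:ℝ) else 0) + Torus.partialDeriv c (E.disp m t w) y i| ≤ ‖E.flowDeriv m t w y‖ := by
  rw [← flowDeriv_apply_single E m t w hsm y i c]
  have h1 : |(E.flowDeriv m t w y (EuclideanSpace.single c (1:ℝ))) i| ≤ ‖E.flowDeriv m t w y (EuclideanSpace.single c (1:ℝ))‖ := by
    have := PiLp.norm_apply_le (E.flowDeriv m t w y (EuclideanSpace.single c (1:ℝ))) i
    simpa [Real.norm_eq_abs] using this
  refine h1.trans ?_
  calc ‖E.flowDeriv m t w y (EuclideanSpace.single c (1:ℝ))‖ ≤ ‖E.flowDeriv m t w y‖ * ‖EuclideanSpace.single c (1:ℝ)‖ :=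
        ContinuousLinearMap.le_opNorm _ _
    _ = ‖E.flowDeriv m t w y‖ := by rw [EuclideanSpace.single, PiLp.norm_single, norm_one, mul_one]


/-! ## §2 A Lagrangian level is the weak divergence of a bounded antisymmetric potential -/

/-- **Sup bound of a Lagrangian level from a flow-derivative bound.** If `‖flowDeriv m t w y‖ ≤ μ` on every refresh window of level `m+1`
(`w` its left end), then `‖b (m+1) t x‖ ≤ μ · k a_{m+1} / (2π N_{m+1})` (`IsInserted` + `‖level‖ ≤ k a/(2πN)`; every `x` is a value of the
window's flow map). [cite: ArmstrongVicol2025, §2.2 (PDF p. 18: |b_m − b_{m−1}| ≲ a_m ε_m)] -/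
theorem norm_b_succ_le_of_flowDeriv_le (E : LagrangianLatticeCarrier k) (m : ℕ) (hL : E.IsLagrangian) (hLR : E.LevelRegular) {μ : ℝ}
    (hμ : ∀ (j : ℤ), ∀ t ∈ E.window (m + 1) j, ∀ y, ‖E.flowDeriv m t ((j : ℝ) * E.refresh (m + 1)) y‖ ≤ μ)
    (t : ℝ) (x : UnitAddTorus (Fin 3)) :
    ‖E.b (m + 1) t x‖ ≤ μ * (k * E.a (m + 1) / (2 * Real.pi * E.N (m + 1))) := by
  set j : ℤ := ⌊t / E.refresh (m + 1)⌋ with hj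
  have ht : t ∈ E.window (m + 1) j := mem_window_floor E (m + 1) t
  set w : ℝ := (j : ℝ) * E.refresh (m + 1) with hw
  set y : UnitAddTorus (Fin 3) := E.X m w t x with hy
  have hxy : E.X m t w y = x := X_X_symm E hLR m t w x
  have hins := (hL m).2 j t ht y
  rw [hxy] at hins
  rw [hins]
  have hμ0 : 0 ≤ μ := (norm_nonneg _).trans (hμ j t ht y)
  have hpos : 0 ≤ (k : ℝ) * E.a (m + 1) / (2 * Real.pi * E.N (m + 1)) := by
    have := E.toFractalCarrierData.a_pos (m + 1); have := E.toFractalCarrierData.N_pos (m + 1); positivity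
  calc ‖E.flowDeriv m t w y (E.toFractalCarrierData.level (m + 1) t y)‖
      ≤ ‖E.flowDeriv m t w y‖ * ‖E.toFractalCarrierData.level (m + 1) t y‖ := ContinuousLinearMap.le_opNorm _ _
    _ ≤ μ * (k * E.a (m + 1) / (2 * Real.pi * E.N (m + 1))) :=
        mul_le_mul (hμ j t ht y) (norm_level_le _ _ t y) (norm_nonneg _) hμ0

/-- **A Lagrangian level is the weak divergence of a bounded antisymmetric stream potential.** For a Lagrangian carrier with regular levels and
flows, and a flow-derivative bound `‖flowDeriv m t w y‖ ≤ μ` on the refresh windows of level `m+1`: at every time `t` there is an antisymmetric,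
continuous potential `ψ` on `𝕋³` with `|ψ_{ia}| ≤ 9 μ² · k a_{m+1}/(2π² N_{m+1}²)` and `∫ (b (m+1) t)_a φ = −∫ Σ_i ψ_{ia} ∂_i φ` for every smooth `φ`
— the envelope-weighted Kolmogorov-layer potentials of the Eulerian level (`…StreamPotentialWord`) pushed forward by the window's coarse flow
`X m t w` (`…StreamPushforward`: `ψ = (M Ψ Mᵀ) ∘ X m w t`, `M = DX`, the Hessian term killed by antisymmetry).
[cite: ArmstrongVicol2025, §2.2 (PDF p. 18: the inserted levels ψ_{m,k} ∘ X^{-1}_{m−1} as stream functions in the Lagrangian frame, |ψ_{m,k}| ≤ a_m ε_m²)] -/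
theorem exists_level_stream_potential (E : LagrangianLatticeCarrier k) (m : ℕ) (hL : E.IsLagrangian) (hLR : E.LevelRegular) {μ : ℝ}
    (hμ : ∀ (j : ℤ), ∀ t ∈ E.window (m + 1) j, ∀ y, ‖E.flowDeriv m t ((j : ℝ) * E.refresh (m + 1)) y‖ ≤ μ) (t : ℝ) :
    ∃ ψ : UnitAddTorus (Fin 3) → Fin 3 → Fin 3 → ℝ,
      (∀ x i a, ψ x i a = -ψ x a i) ∧
      (∀ x i a, |ψ x i a| ≤ 9 * μ ^ 2 * (E.a (m + 1) * k / (2 * Real.pi ^ 2 * (E.N (m + 1) : ℝ) ^ 2))) ∧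
      (∀ i a, Continuous fun x => ψ x i a) ∧
      (∀ φ : UnitAddTorus (Fin 3) → ℝ, IsSmooth φ → ∀ a,
        ∫ x, E.b (m + 1) t x a * φ x = -∫ x, ∑ i, ψ x i a * Torus.partialDeriv i φ x) := by
  -- the window of `t`, its left end, the displacement and the inverse flow
  set j : ℤ := ⌊t / E.refresh (m + 1)⌋ with hj
  have ht : t ∈ E.window (m + 1) j := mem_window_floor E (m + 1) t
  set w : ℝ := (j : ℝ) * E.refresh (m + 1) with hw
  set u : UnitAddTorus (Fin 3) → EuclideanSpace ℝ (Fin 3) := E.disp m t w with hu_def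
  have hu : IsSmooth u := hLR.isSmooth_disp m t w
  have hS : MeasurePreserving (fun x : UnitAddTorus (Fin 3) => x + proj (u x)) volume volume := by
    have e : (fun x : UnitAddTorus (Fin 3) => x + proj (u x)) = E.X m t w := by
      funext x; rw [LagrangianLatticeCarrier.X_apply]
    rw [e]; exact hLR.measurePreserving_X m t w
  set S' : UnitAddTorus (Fin 3) → UnitAddTorus (Fin 3) := E.X m w t with hS'_def
  have hS'c : Continuous S' := by
    have hd : Continuous fun x : UnitAddTorus (Fin 3) => E.disp m w t x :=
      (hLR.continuous_disp m t).comp (Continuous.prodMk_right w)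
    have e : S' = fun x => x + proj (E.disp m w t x) := by
      funext x; rw [hS'_def, LagrangianLatticeCarrier.X_apply]
    rw [e]
    exact continuous_id.add (continuous_proj.comp hd)
  have hS'l : ∀ y, S' (y + proj (u y)) = y := by
    intro y
    have e : y + proj (u y) = E.X m t w y := by rw [LagrangianLatticeCarrier.X_apply]
    rw [e]
    exact X_X_symm E hLR m w t y
  -- the Eulerian level and its word potential
  set Wd : LatticeWord k := E.toFractalCarrierData.word (m + 1) with hWd
  set n : ℕ := E.N (m + 1) with hn
  have hnpos : 0 < n := E.toFractalCarrierData.N_pos (m + 1)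
  set av : ℝ := E.a (m + 1) with hav
  set s : ℝ := E.a (m + 1) * t with hs
  set v : UnitAddTorus (Fin 3) → EuclideanSpace ℝ (Fin 3) := E.toFractalCarrierData.level (m + 1) t with hv_def
  have hvc : Continuous v := (continuous_uncurry_level E.toFractalCarrierData (m + 1)).uncurry_left t
  have hv : ∀ y, v y = av • Wd.cell n s y := fun y => rfl
  set Ψ : UnitAddTorus (Fin 3) → Fin 3 → Fin 3 → ℝ := (fun y i c =>
    ∑ j, av * LatticeWord.trapezoid (Wd.start j) (Wd.phase j).τ Wd.ramp (Int.fract (s / Wd.period) * Wd.period) *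
        (-((UnitAddTorus.mFourier (fun l => (Wd.phase j).m l * n) y * Complex.exp ((Wd.phase j).φ * Complex.I)).re) *
          (((Wd.phase j).m i : ℝ) * (Wd.phase j).e c - (Wd.phase j).e i * ((Wd.phase j).m c : ℝ)) /
            (4 * Real.pi ^ 2 * (n : ℝ) ^ 2 * ‖latticeVec (Wd.phase j).m‖ ^ 3))) with hΨ_def
  have hΨ : ∀ φ : UnitAddTorus (Fin 3) → ℝ, IsSmooth φ → ∀ c : Fin 3,
      ∫ y, v y c * φ y = -∫ y, ∑ i, Ψ y i c * Torus.partialDeriv i φ y := by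
    intro φ hφ c
    have h := integral_cell_mul_eq_neg_integral_potential Wd n hnpos av s hφ c
    simpa only [hv] using h
  have hΨanti : ∀ y i c, Ψ y i c = -Ψ y c i := by
    intro y i c
    simp only [hΨ_def, ← Finset.sum_neg_distrib]
    refine Finset.sum_congr rfl fun j _ => ?_
    ring
  have hΨc : ∀ i c, Continuous fun y => Ψ y i c := by
    intro i c
    simp only [hΨ_def]
    refine continuous_finsetSum _ fun j _ => ?_
    have hF : Continuous fun y : UnitAddTorus (Fin 3) =>
        (UnitAddTorus.mFourier (fun l => (Wd.phase j).m l * n) y * Complex.exp ((Wd.phase j).φ * Complex.I)).re :=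
      Complex.continuous_re.comp (((UnitAddTorus.mFourier _).continuous).mul continuous_const)
    exact continuous_const.mul ((hF.neg.mul continuous_const).div_const _)
  have hΨΛ : ∀ y i c, |Ψ y i c| ≤ av * k / (2 * Real.pi ^ 2 * (n : ℝ) ^ 2) := by
    intro y i c
    have h := abs_cellPotential_le Wd n hnpos av s y i c
    rw [abs_of_pos (E.toFractalCarrierData.a_pos (m + 1))] at h
    simpa only [hΨ_def] using h
  -- the inserted level: `b (m+1) t (X m t w y) = flowDeriv m t w y (v y)`
  set b : UnitAddTorus (Fin 3) → EuclideanSpace ℝ (Fin 3) := E.b (m + 1) t with hb_def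
  have hbm : AEStronglyMeasurable b volume := ((hLR.continuous_uncurry_b m).uncurry_left t).aestronglyMeasurable
  have hb : ∀ y, b (y + proj (u y)) = (ContinuousLinearMap.id ℝ (EuclideanSpace ℝ (Fin 3)) + Torus.fderiv u y) (v y) := by
    intro y
    have hins := (hL m).2 j t ht y
    rw [LagrangianLatticeCarrier.X_apply, flowDeriv_eq_id_add_fderiv] at hins
    exact hins
  -- the pushforward
  set M : UnitAddTorus (Fin 3) → Fin 3 → Fin 3 → ℝ := (fun y a c =>
    (if a = c then (1:ℝ) else 0) + Torus.partialDeriv c u y a) with hM_def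
  have hMμ : ∀ y i c, |M y i c| ≤ μ := by
    intro y i c
    have h := abs_flowDeriv_entry_le E m t w hu y i c
    exact h.trans (hμ j t ht y)
  have hMc : ∀ a c, Continuous fun y => M y a c := fun a c =>
    ((isSmooth_const _).add ((hu.partialDeriv c).apply a)).continuous
  refine ⟨fun x d a => ∑ i, ∑ c, M (S' x) d i * Ψ (S' x) i c * M (S' x) a c, ?_, ?_, ?_, ?_⟩
  · intro x d a
    exact pushforwardPotential_antisymm (M (S' x)) (Ψ (S' x)) (hΨanti (S' x)) d a
  · intro x d a
    have h := abs_pushforwardPotential_le (M (S' x)) (Ψ (S' x)) (hMμ (S' x)) (hΨΛ (S' x)) d a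
    simpa only [hav, hn] using h
  · intro d a
    exact continuous_finsetSum _ fun i _ => continuous_finsetSum _ fun c _ =>
      (((hMc d i).comp hS'c).mul ((hΨc i c).comp hS'c)).mul ((hMc a c).comp hS'c)
  · intro φ hφ a
    have key := integral_pushforward_mul_eq_neg_integral_potential hu hS hS'c hS'l hvc hbm hb hΨanti hΨc hΨ φ hφ a
    simpa only [hM_def] using key


/-! ## §3 Template bookkeeping: the sizes of the tail -/

/-- The renormalised viscosities decrease: `kbar_{m+1} ≤ kbar_m` (Taylor recursion with a positive gain term).
[cite: ArmstrongVicol2025, §3 (3.42)–(3.43)] -/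
theorem kbar_succ_le (D : FractalCarrierData k) (hP : D.Permissible) (m : ℕ) : D.kbar (m + 1) ≤ D.kbar m := by
  have hrec := hP.2.2.2.1 m
  have hk := D.kbar_pos (m + 1)
  have hN : (0 : ℝ) < D.N (m + 1) := by exact_mod_cast D.N_pos (m + 1)
  have hg : 0 ≤ D.gain * D.a (m + 1) ^ 2 / (D.kbar (m + 1) ^ 2 * (D.N (m + 1) : ℝ) ^ 4) := by
    have := D.gain_pos; positivity
  rw [hrec]
  nlinarith

/-- `kbar` is antitone: `kbar_m ≤ kbar_j` for `j ≤ m`. [cite: ArmstrongVicol2025, §3 (3.42)–(3.43)] -/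
theorem kbar_le_of_le (D : FractalCarrierData k) (hP : D.Permissible) {j m : ℕ} (h : j ≤ m) : D.kbar m ≤ D.kbar j := by
  induction m, h using Nat.le_induction with
  | base => exact le_rfl
  | succ m _ ih => exact (kbar_succ_le D hP m).trans ih

/-- The template ratio `q = 2^{-1/4}` lies in `[0, 1)`. [folklore] -/
theorem quarterRatio_nonneg_lt_one : 0 ≤ ((1 / 2 : ℝ) ^ (1 / 4 : ℝ)) ∧ ((1 / 2 : ℝ) ^ (1 / 4 : ℝ)) < 1 :=
  ⟨by positivity, Real.rpow_lt_one (by norm_num) (by norm_num) (by norm_num)⟩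

/-- **Potential scale of a level against the renormalised viscosity below it**: `a_{m+1}/N_{m+1}² ≤ kbar_m · q^m / gain` on the template.
[cite: ArmstrongVicol2025, §3 (3.42)–(3.43)] -/
theorem potentialScale_le_kbar_mul (D : FractalCarrierData k) (hP : D.Permissible)
    (hT2 : ∀ m, D.cellVisc (m + 1) * ((D.N (m + 1) : ℝ) / D.N m) ^ (1 / 4 : ℝ) ≤ 1)
    (hsq : ∀ m, D.N m ^ 2 ≤ D.N (m + 1)) (m : ℕ) :
    D.a (m + 1) / (D.N (m + 1) : ℝ) ^ 2 ≤ D.kbar m * (((1 / 2 : ℝ) ^ (1 / 4 : ℝ)) ^ m / D.gain) := by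
  have h := potentialScale_div_kbar_le_half_pow D hP hT2 hsq m
  have hk := D.kbar_pos m
  rwa [div_le_iff₀ hk, mul_comm] at h

/-- The potential scales `a_{m+1}/N_{m+1}²` are summable on the template. [folklore] -/
theorem summable_potentialScale (D : FractalCarrierData k) (hP : D.Permissible)
    (hT2 : ∀ m, D.cellVisc (m + 1) * ((D.N (m + 1) : ℝ) / D.N m) ^ (1 / 4 : ℝ) ≤ 1)
    (hsq : ∀ m, D.N m ^ 2 ≤ D.N (m + 1)) :
    Summable fun m => D.a (m + 1) / (D.N (m + 1) : ℝ) ^ 2 := by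
  obtain ⟨hq0, hq1⟩ := quarterRatio_nonneg_lt_one
  have hgeom : Summable fun m : ℕ => D.kbar 0 * (((1 / 2 : ℝ) ^ (1 / 4 : ℝ)) ^ m / D.gain) := by
    have h := (summable_geometric_of_lt_one hq0 hq1).mul_left (D.kbar 0 / D.gain)
    refine h.congr fun m => ?_
    ring
  refine Summable.of_nonneg_of_le (fun m => ?_) (fun m => ?_) hgeom
  · have := D.a_pos (m + 1); positivity
  · refine (potentialScale_le_kbar_mul D hP hT2 hsq m).trans ?_
    have hk0 : D.kbar m ≤ D.kbar 0 := kbar_le_of_le D hP (Nat.zero_le m)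
    have : 0 ≤ ((1 / 2 : ℝ) ^ (1 / 4 : ℝ)) ^ m / D.gain := by have := D.gain_pos; positivity
    exact mul_le_mul_of_nonneg_right hk0 this

/-- **The tail of the potential scales is `o(kbar_j)`**: `Σ_{m ≥ 0} a_{m+j+1}/N_{m+j+1}² ≤ kbar_j · q^j / ((1 − q) · gain)`, `q = 2^{-1/4}`.
[cite: ArmstrongVicol2025, §3 (3.42)–(3.43)] -/
theorem tsum_potentialScale_tail_le (D : FractalCarrierData k) (hP : D.Permissible)
    (hT2 : ∀ m, D.cellVisc (m + 1) * ((D.N (m + 1) : ℝ) / D.N m) ^ (1 / 4 : ℝ) ≤ 1)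
    (hsq : ∀ m, D.N m ^ 2 ≤ D.N (m + 1)) (j : ℕ) :
    ∑' m, D.a (m + j + 1) / (D.N (m + j + 1) : ℝ) ^ 2 ≤
      D.kbar j * (((1 / 2 : ℝ) ^ (1 / 4 : ℝ)) ^ j / ((1 - (1 / 2 : ℝ) ^ (1 / 4 : ℝ)) * D.gain)) := by
  obtain ⟨hq0, hq1⟩ := quarterRatio_nonneg_lt_one
  set q : ℝ := (1 / 2 : ℝ) ^ (1 / 4 : ℝ) with hq
  have hk := D.kbar_pos j
  have hg := D.gain_pos
  -- termwise bound by a geometric sequence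
  have hterm : ∀ m, D.a (m + j + 1) / (D.N (m + j + 1) : ℝ) ^ 2 ≤ D.kbar j * q ^ j / D.gain * q ^ m := by
    intro m
    have h1 := potentialScale_le_kbar_mul D hP hT2 hsq (m + j)
    have h2 : D.kbar (m + j) ≤ D.kbar j := kbar_le_of_le D hP (Nat.le_add_left j m)
    have h3 : 0 ≤ q ^ (m + j) / D.gain := by positivity
    calc D.a (m + j + 1) / (D.N (m + j + 1) : ℝ) ^ 2 ≤ D.kbar (m + j) * (q ^ (m + j) / D.gain) := h1
      _ ≤ D.kbar j * (q ^ (m + j) / D.gain) := mul_le_mul_of_nonneg_right h2 h3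
      _ = D.kbar j * q ^ j / D.gain * q ^ m := by rw [pow_add]; ring
  have hgeo : Summable fun m : ℕ => D.kbar j * q ^ j / D.gain * q ^ m := (summable_geometric_of_lt_one hq0 hq1).mul_left _
  have hsum : Summable fun m => D.a (m + j + 1) / (D.N (m + j + 1) : ℝ) ^ 2 :=
    Summable.of_nonneg_of_le (fun m => by have := D.a_pos (m + j + 1); positivity) hterm hgeo
  calc ∑' m, D.a (m + j + 1) / (D.N (m + j + 1) : ℝ) ^ 2 ≤ ∑' m : ℕ, D.kbar j * q ^ j / D.gain * q ^ m :=
        Summable.tsum_le_tsum hterm hsum hgeo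
    _ = D.kbar j * q ^ j / D.gain * ∑' m : ℕ, q ^ m := tsum_mul_left
    _ = D.kbar j * q ^ j / D.gain * (1 - q)⁻¹ := by rw [tsum_geometric_of_lt_one hq0 hq1]
    _ = D.kbar j * (q ^ j / ((1 - q) * D.gain)) := by
        have h1q : (1 - q) ≠ 0 := by linarith
        field_simp

/-- **The velocity scales `a_{m+1}/N_{m+1}` are summable** (amplitude decay (A) of `LPermissible`: `a_{m+1} ≤ N_{m+1}^{1−α₀}`, and `N_{m+1} ≥ 2^{m+1}`).
[cite: ArmstrongVicol2025, §2.2 (PDF p. 18: |ψ_{m,k}| ≤ a_m ε_m² = ε_m^β, summable over m)] -/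
theorem summable_amplitudeScale (D : FractalCarrierData k) (hP : D.Permissible) {α₀ : ℝ} (hα₀ : 0 < α₀)
    (hA : ∀ m, D.a (m + 1) ≤ ((D.N (m + 1) : ℝ)) ^ (1 - α₀)) :
    Summable fun m => D.a (m + 1) / (D.N (m + 1) : ℝ) := by
  set r : ℝ := (2 : ℝ) ^ (-α₀) with hr
  have hr0 : 0 ≤ r := by positivity
  have hr1 : r < 1 := Real.rpow_lt_one_of_one_lt_of_neg (by norm_num) (by linarith)
  have hgeo : Summable fun m : ℕ => r ^ (m + 1) := by
    simpa only [pow_succ] using (summable_geometric_of_lt_one hr0 hr1).mul_right r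
  refine Summable.of_nonneg_of_le (fun m => ?_) (fun m => ?_) hgeo
  · have := D.a_pos (m + 1); have := D.N_pos (m + 1); positivity
  · have hN : (0 : ℝ) < D.N (m + 1) := by exact_mod_cast D.N_pos (m + 1)
    have h2N : (2 : ℝ) ^ (m + 1) ≤ D.N (m + 1) := by exact_mod_cast two_pow_le_N D hP (m + 1)
    calc D.a (m + 1) / (D.N (m + 1) : ℝ) ≤ (D.N (m + 1) : ℝ) ^ (1 - α₀) / (D.N (m + 1) : ℝ) :=
          div_le_div_of_nonneg_right (hA m) hN.le
      _ = (D.N (m + 1) : ℝ) ^ (-α₀) := by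
          rw [Real.rpow_sub hN, Real.rpow_one, Real.rpow_neg hN.le, div_eq_mul_inv]
          field_simp
      _ ≤ ((2 : ℝ) ^ (m + 1)) ^ (-α₀) := Real.rpow_le_rpow_of_nonpos (by positivity) h2N (by linarith)
      _ = r ^ (m + 1) := by
          rw [hr, ← Real.rpow_natCast, ← Real.rpow_mul (by norm_num), mul_comm, Real.rpow_mul (by norm_num),
            Real.rpow_natCast]

end Summit.AnomalousDissipation.AnomalousDissipation.Theorems.SolenoidalFractalHomogenisation.LagrangianRenormalisationStep

end
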